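import Literature.MathematicalPhysics.QuantumLattice.PeierlsContourExpansion
import HarnessLib

/-!
# Fröhlich–Lieb (1.29)–(1.30) in the CONTOUR-ASSIGNMENT form:
# `⟨Pₘ⁺Pₙ⁻⟩ ≤ Σ_{γ ∈ 𝒢} ⟨∏_{⟨i,j⟩ ∈ γ} Pᵢ⁺Pⱼ⁻⟩` for any compatible assignment `c ↦ γ(c) ∈ 𝒢`

Topic `MathematicalPhysics/QuantumLattice`; companion of `PeierlsContourExpansion` (which indexes
the Peierls expansion by the `+` cluster of `m` and keeps its FULL boundary). Fröhlich–Lieb index it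
instead by ONE contour `γ(c) ∈ Γ(c)` chosen for each configuration `c` (in `d = 2`: the connected
component of the boundary of the `+` cluster that separates `m` from `n`) and bound the fibre over
`γ` by the sum over ALL configurations compatible with `γ` (their (1.29):
`Σ_{c : γ(c) = γ} ≤ Σ_{c : γ ∈ Γ(c)} = ⟨Pₘ⁺Pₙ⁻ ∏_γ Pᵢ⁺Pⱼ⁻⟩ ≤ ⟨∏_γ Pᵢ⁺Pⱼ⁻⟩`). This is what makes
the number of terms of a given length grow only exponentially (FL Thm. 1.1). The analytic content
is model- and topology-free and is proved here for an ARBITRARY assignment: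

* **`peierls_bound_of_assignment`** — for single-site `0 ≤ P±` with `P⁺ + P⁻ = 1`, sites `m ≠ n`, a
  state `ω` nonnegative on positive matrices, any finite index set `𝒢` with site sets `S₊(γ)`,
  `S₋(γ)` (`S₊ ∩ S₋ = ∅`) and ANY map `c ↦ γ(c) ∈ 𝒢` on the configurations (`c(m) = +`, `c(n) = -`)
  that is compatible (`c = +` on `S₊(γ(c))`, `c = -` on `S₋(γ(c))`):
  `Re ω(Pₘ⁺Pₙ⁻) ≤ Σ_{γ ∈ 𝒢} Re ω(∏_{S₊(γ)} P⁺ ∏_{S₋(γ)} P⁻)`;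
* `peierls_bound_of_assignment_gibbs` — the same for the Gibbs state of a Hermitian Hamiltonian.

The topological input of FL Thm. 1.1 (a connected separating contour exists for every `c`; there are
at most `2(l-1)3^{2l-2}` of length `2l`) enters only through the choice of `𝒢` and `γ(·)` and is not
formalised here. No named facts; no sorries.

## References

* J. Fröhlich, E. H. Lieb, *Phase transitions in anisotropic lattice spin systems*, Comm. Math.
  Phys. **60** (1978) 233–267, §I.C Definition 1, eqs. (1.26)–(1.30), Thm. 1.1. [FrohlichLieb1978]
-/

noncomputable section

open Matrix Finset
open scoped ComplexOrder MatrixOrder BigOperators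

namespace Literature.MathematicalPhysics.QuantumLattice

variable {Λ : Type*} [Fintype Λ] [DecidableEq Λ] {q : ℕ}

/-- The configurations compatible with prescribed signs (`+` on `Sp`, `-` on `Sm`) form a box, and
the sum of their observables `Q_c = ⨂ P^{c(j)}` is the product observable `∏_{Sp} P⁺ ∏_{Sm} P⁻`
(free sites carry `P⁺ + P⁻ = 1`) — FL (1.29), the resummation `Σ_{c : γ ∈ Γ(c)}`.
[cite: FrohlichLieb1978, eq. (1.29)] -/
theorem sum_configOp_compatible {Pp Pm : Matrix (Fin q) (Fin q) ℂ} (hsum : Pp + Pm = 1)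
    {Sp Sm : Finset Λ} (hdisj : Disjoint Sp Sm) :
    ∑ c ∈ (univ : Finset (Λ → Bool)).filter
        (fun c => (∀ x ∈ Sp, c x = true) ∧ ∀ x ∈ Sm, c x = false), configOp Pp Pm c =
      productOp fun j => if j ∈ Sp then Pp else if j ∈ Sm then Pm else 1 := by
  classical
  set T : Λ → Finset Bool := fun j => if j ∈ Sp then {true} else if j ∈ Sm then {false} else univ
    with hT
  have hbox : (univ : Finset (Λ → Bool)).filter
      (fun c => (∀ x ∈ Sp, c x = true) ∧ ∀ x ∈ Sm, c x = false) = Fintype.piFinset T := by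
    ext c
    rw [mem_filter, Fintype.mem_piFinset]
    simp only [mem_univ, true_and]
    constructor
    · rintro ⟨hp, hm⟩ j
      simp only [hT]
      by_cases hjp : j ∈ Sp
      · rw [if_pos hjp, mem_singleton]; exact hp j hjp
      · rw [if_neg hjp]
        by_cases hjm : j ∈ Sm
        · rw [if_pos hjm, mem_singleton]; exact hm j hjm
        · rw [if_neg hjm]; exact mem_univ _
    · intro h
      refine ⟨fun j hj => ?_, fun j hj => ?_⟩
      · have := h j
        simp only [hT, if_pos hj, mem_singleton] at this
        exact this
      · have hjp : j ∉ Sp := fun h' => disjoint_left.1 hdisj h' hj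
        have := h j
        simp only [hT, if_neg hjp, if_pos hj, mem_singleton] at this
        exact this
  rw [hbox]
  have hexp := productOp_piFinset_sum (Λ := Λ) T (fun _ s => if s then Pp else Pm)
  simp only [configOp]
  rw [← hexp]
  congr 1
  funext j
  simp only [hT]
  by_cases hjp : j ∈ Sp
  · rw [if_pos hjp, if_pos hjp, sum_singleton, if_pos rfl]
  · rw [if_neg hjp, if_neg hjp]
    by_cases hjm : j ∈ Sm
    · rw [if_pos hjm, if_pos hjm, sum_singleton]
      rfl
    · rw [if_neg hjm, if_neg hjm, Fintype.sum_bool, ← hsum]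
      rfl

/-- **Fröhlich–Lieb (1.29)–(1.30) for an arbitrary compatible contour assignment.** Single-site
`0 ≤ P±` with `P⁺ + P⁻ = 1`, sites `m ≠ n`, a state `ω` nonnegative on positive semidefinite
matrices; `𝒢` a finite index set with disjoint site sets `S₊(γ)`, `S₋(γ)`; `c ↦ γ(c)` ANY map
sending each configuration with `c(m) = +`, `c(n) = -` to a `γ(c) ∈ 𝒢` compatible with it. Then
`Re ω(Pₘ⁺Pₙ⁻) ≤ Σ_{γ ∈ 𝒢} Re ω(∏_{S₊(γ)} P⁺ ∏_{S₋(γ)} P⁻)`: expand (1.26)–(1.27), group by `γ(c)`,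
enlarge each fibre to all compatible configurations (every `ω(Q_c) ≥ 0`) and resum, (1.29).
[cite: FrohlichLieb1978, eqs. (1.26)–(1.30)] -/
theorem peierls_bound_of_assignment {Pp Pm : Matrix (Fin q) (Fin q) ℂ} (hPp : Pp.PosSemidef)
    (hPm : Pm.PosSemidef) (hsum : Pp + Pm = 1) {m n : Λ} (hmn : m ≠ n) (ω : Op Λ q →ₗ[ℂ] ℂ)
    (hω : ∀ X : Op Λ q, X.PosSemidef → 0 ≤ (ω X).re) {ι : Type*} (𝒢 : Finset ι)
    (Sp Sm : ι → Finset Λ) (hdisj : ∀ g ∈ 𝒢, Disjoint (Sp g) (Sm g)) (γof : (Λ → Bool) → ι)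
    (hγ : ∀ c ∈ validConfigs m n,
      γof c ∈ 𝒢 ∧ (∀ x ∈ Sp (γof c), c x = true) ∧ ∀ x ∈ Sm (γof c), c x = false) :
    (ω (onSite m Pp * onSite n Pm)).re ≤
      ∑ g ∈ 𝒢, (ω (productOp fun j => if j ∈ Sp g then Pp else if j ∈ Sm g then Pm else 1)).re := by
  classical
  have hQ : ∀ c : Λ → Bool, 0 ≤ (ω (configOp Pp Pm c)).re := fun c =>
    hω _ (productOp_posSemidef fun j => by split_ifs; exacts [hPp, hPm])
  rw [onSite_mul_onSite_eq_sum_configOp hsum hmn, map_sum, Complex.re_sum,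
    ← Finset.sum_fiberwise_of_maps_to (g := γof) (fun c hc => (hγ c hc).1)]
  refine sum_le_sum fun g hg => ?_
  -- enlarge the fibre to the compatible box and resum it
  calc ∑ c ∈ (validConfigs m n).filter (fun c => γof c = g), (ω (configOp Pp Pm c)).re
      ≤ ∑ c ∈ (univ : Finset (Λ → Bool)).filter
          (fun c => (∀ x ∈ Sp g, c x = true) ∧ ∀ x ∈ Sm g, c x = false),
          (ω (configOp Pp Pm c)).re := by
        refine sum_le_sum_of_subset_of_nonneg (fun c hc => ?_) fun c _ _ => hQ c
        rw [mem_filter] at hc ⊢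
        obtain ⟨hcv, hcg⟩ := hc
        obtain ⟨-, hp, hm⟩ := hγ c hcv
        rw [hcg] at hp hm
        exact ⟨mem_univ _, hp, hm⟩
    _ = (ω (productOp fun j => if j ∈ Sp g then Pp else if j ∈ Sm g then Pm else 1)).re := by
        rw [← sum_configOp_compatible hsum (hdisj g hg), map_sum, Complex.re_sum]

/-- **FL (1.30) for the Gibbs state, contour-assignment form.**
[cite: FrohlichLieb1978, eq. (1.30)] -/
theorem peierls_bound_of_assignment_gibbs {Pp Pm : Matrix (Fin q) (Fin q) ℂ} (hPp : Pp.PosSemidef)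
    (hPm : Pm.PosSemidef) (hsum : Pp + Pm = 1) {m n : Λ} (hmn : m ≠ n) (β : ℝ) {H : Op Λ q}
    (hH : H.IsHermitian) {ι : Type*} (𝒢 : Finset ι) (Sp Sm : ι → Finset Λ)
    (hdisj : ∀ g ∈ 𝒢, Disjoint (Sp g) (Sm g)) (γof : (Λ → Bool) → ι)
    (hγ : ∀ c ∈ validConfigs m n,
      γof c ∈ 𝒢 ∧ (∀ x ∈ Sp (γof c), c x = true) ∧ ∀ x ∈ Sm (γof c), c x = false) :
    (Matrix.gibbsState β H (onSite m Pp * onSite n Pm)).re ≤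
      ∑ g ∈ 𝒢, (Matrix.gibbsState β H
        (productOp fun j => if j ∈ Sp g then Pp else if j ∈ Sm g then Pm else 1)).re :=
  peierls_bound_of_assignment hPp hPm hsum hmn (Matrix.gibbsState β H)
    (fun _ hX => (Complex.nonneg_iff.1 (Matrix.gibbsState_nonneg_of_posSemidef β hH hX)).1)
    𝒢 Sp Sm hdisj γof hγ

end Literature.MathematicalPhysics.QuantumLattice

end
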